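import Literature.Computability.AlgebraicComplexity.MoreAsymmetricExponent
import Literature.Computability.AlgebraicComplexity.GlobalStageCellData
import HarnessLib

/-!
# The data of one cell of an `ε`-interface tensor as the data of one region of the more asymmetric
Prop. 5.1 (Alman–Duan–Vassilevska Williams–Xu–Xu–Zhou 2025, proof of Thm. 5.3: "a corollary of
Prop. 5.1 … similar to the proof of [VXXZ24]") — proved

Topic `Literature/Computability/AlgebraicComplexity`.  Theorem 5.3 of Alman–Duan–Vassilevska Williams–
Xu–Xu–Zhou, *More asymmetry yields faster matrix multiplication* (SODA 2025, arXiv:2404.16349) is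
obtained from Prop. 5.1 exactly as VXXZ 2024 obtain their Thm. 5.3 from their Prop. 5.1 ("We omit its
proof as it is similar to the proof of [VXXZ24]"): Prop. 5.1 is applied once for every realised CELL of
the `ε`-interface tensor `𝒯_{τ₀, L(β), ε}` (`InterfaceEpsilonCells.lean`), with the realised split
distributions as targets.  `GlobalStageCellData.lean` supplies the datum `cellData` of such a cell and
checks the hypotheses of the VXXZ one-region theorem; this file checks the ADDITIONAL hypotheses of the
more asymmetric one-region theorem `advxxz2025_prop51_region_logb` (`MoreAsymmetricExponent.lean`) and
applies it:

* `cellGammaFun_revXY`, `cellData_moreAsymWellFormed` — **Remark 5.2's third convention holds for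
  realised distributions**: `ξ_{Y,i,j,0}(L) = ξ_{X,i,j,0}(2⃗ − L)` (on a term `(i,j,0)` the `Z`-chunks have
  level `0`, so the realised `Y`-chunks are the reversed `X`-chunks — Claim 5.7), hence the cell datum is
  `MoreAsym.WellFormed`;
* `isUsefulFor_cell_y`, `mem_typicalPairsY_cell`, `mem_levelBlocksX_coarseY_cell`, `coarseYProfile`,
  `coarseYProfile_eq_mul` — the realising `Y`-block `ŷ` is useful, hence `Y`-typical and `Y`-compatible
  (in the form of Claim 5.18), so `(J₀, ŷ)` is a typical `Y`-pair and the class types `k^Y_S` of `ŷ` are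
  the integral data `|S| β_S` of Claim 5.17;
* `MoreAsym.modulusBound_le_crudeModulus` — the cell-independent bound `M₀ ≤ (160cn + 2c + 11)(2c+1)^{3n}`
  (`crudeModulus`) holds for the more asymmetric `M₀` as well, so the SAME lower-order term `thm53Err`
  (`O(√n)`) serves;
* `advxxz2025_thm53_cell` — **Prop. 5.1 (more asymmetric) for the cell**: `(CW_q^{⊗c})^{⊗n} ≥ ⟨κ⟩ ⊗ 𝒯_cell`
  with `log₂(κ+1) ≥ n · min{H(Q_X/n) − P, H(θ_ŷ/n) − Λ^Y_ŷ/n, H(θ_ẑ/n) − Λ^Z_ẑ/n, H(Q/n)} − thm53Err`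
  (`P` the penalty at the type, `θ_ŷ`, `θ_ẑ` the joint types of `(J₀, ŷ)`, `(K₀, ẑ)`,
  `Λ^Y_ŷ = ∑_S |S| H(k^Y_S/|S|)` over the Claim-5.18 classes (`= n η_Y` at the realised distributions),
  `Λ^Z_ẑ` over the VXXZ Def-5.15 classes (`= n λ_Z`)).

Everything is proved; the definitions are `coarseYProfile`; no named facts.  The comparison of the cell
exponent with the target exponent (continuity) and the direct sum over the cells (merge) are the
remaining steps of Thm. 5.3, as in `GlobalStageEpsilon.lean`.

## References

* J. Alman, R. Duan, V. Vassilevska Williams, Y. Xu, Z. Xu, R. Zhou, *More asymmetry yields faster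
  matrix multiplication*, SODA 2025, arXiv:2404.16349 (held: `paper:arxiv-2404.16349`, chunks p0015,
  p0017): Prop. 5.1, Thm. 5.3, Remark 5.2, Claim 5.7. [AlmanDuanVassilevskaWilliamsXuXuZhou2025]
* V. Vassilevska Williams, Y. Xu, Z. Xu, R. Zhou, *New bounds for matrix multiplication: from alpha
  to omega*, SODA 2024, arXiv:2307.07970, Thm. 5.3 (proof). [VassilevskaWilliamsXuXuZhou2024]
-/

noncomputable section

open scoped BigOperators
open Finset

namespace Literature.Computability.AlgebraicComplexity

open Literature.Barriers.MatrixMultiplication (bigCwTensor)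

universe u

/-! ## A realised cell: Remark 5.2 (`Y`-form), usefulness and typicality of the realising `Y`-block -/

section Realised

variable (K : Type u) [CommSemiring K] (q : ℕ) {c n : ℕ}
variable {Q : Fin (2 * c + 1) × Fin (2 * c + 1) × Fin (2 * c + 1) → ℕ}
variable {T₀ : (Fin n → Fin (2 * c + 1)) × (Fin n → Fin (2 * c + 1)) × (Fin n → Fin (2 * c + 1))}
variable {γX γY γZ : ℕ × ℕ × ℕ → (Fin c → Fin 3) → ℝ} {ε : ℝ} {x y z : Fin n → Fin c → Fin (q + 2)}

/-- **Remark 5.2's third convention holds for the realised split distributions of a cell**: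
`ξ_{Y,i,j,0}(L) = ξ_{X,i,j,0}(2⃗ − L)` — on the chunks of the term `(i,j,0)` the `Z`-block has level `0`,
so the `Y`-chunks are the reversed `X`-chunks (Claim 5.7). [cite: AlmanDuanVassilevskaWilliamsXuXuZhou2025, Remark 5.2 and Claim 5.7] -/
theorem cellGammaFun_revXY (hlev : IsLevelTriple c (seqVal T₀.1) (seqVal T₀.2.1) (seqVal T₀.2.2))
    (hxyz : interfaceTensor K q (tripleTermMap hlev) (tripleTermList c γX γY γZ) ε x y z ≠ 0) (i j : ℕ) (σ : Fin c → Fin 3) :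
    cellGammaFun (tripleTermMap hlev) (profileOf q (tripleTermMap hlev) y) (i, j, 0) σ =
      cellGammaFun (tripleTermMap hlev) (profileOf q (tripleTermMap hlev) x) (i, j, 0) (fun p => (σ p).rev) := by
  by_cases hm : ((i, j, 0) : ℕ × ℕ × ℕ) ∈ constituentTriples c
  · rw [cellGammaFun_of_mem _ _ hm, cellGammaFun_of_mem _ _ hm]
    set s := (constituentTriples c).equivFin ⟨(i, j, 0), hm⟩ with hs
    have hfib : termFibre (tripleTermMap hlev) s = posClass (seqVal T₀.1) (seqVal T₀.2.1) (seqVal T₀.2.2) i j 0 :=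
      termFibre_tripleTermMap_equivFin hlev hm
    have hpow := kroneckerPow_ne_zero_of_interfaceTensor_ne_zero K q hxyz
    have hz : chunkLevels (levelSeq z) = seqVal T₀.2.2 :=
      chunkLevels_eq_of_mem_levelBlocksZ_triple hlev (interfaceTensor_ne_zero K q hxyz).2.2
    change completeSplitOn (levelSeq y) (termFibre (tripleTermMap hlev) s) σ =
      completeSplitOn (levelSeq x) (termFibre (tripleTermMap hlev) s) (fun p => (σ p).rev)
    rw [hfib]
    refine completeSplitOn_rev_on (fun t ht => levelSeq_y_eq_rev_of_chunkLevels_z_eq_zero K q hpow ?_) σ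
    rw [hz]
    exact (mem_posClass.1 ht).2.2
  · rw [cellGammaFun_of_not_mem _ _ hm, cellGammaFun_of_not_mem _ _ hm]; rfl

/-- **The cell data of a realised cell is well formed for the more asymmetric stage** (Remark 5.2, all
three conventions). [cite: AlmanDuanVassilevskaWilliamsXuXuZhou2025, Prop. 5.1 and Remark 5.2] -/
theorem cellData_moreAsymWellFormed (hQs : ∀ s, s ∉ levelSupport (2 * c) → Q s = 0) (hT₀ : T₀ ∈ jointTypeClass n Q)
    (hxyz : interfaceTensor K q (tripleTermMap (isLevelTriple_of_mem_jointTypeClass hQs hT₀)) (tripleTermList c γX γY γZ) ε x y z ≠ 0) :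
    GlobalStageData.MoreAsym.WellFormed
      (cellData Q (tripleTermMap (isLevelTriple_of_mem_jointTypeClass hQs hT₀))
        (profileOf q (tripleTermMap (isLevelTriple_of_mem_jointTypeClass hQs hT₀)) x,
          profileOf q (tripleTermMap (isLevelTriple_of_mem_jointTypeClass hQs hT₀)) y,
          profileOf q (tripleTermMap (isLevelTriple_of_mem_jointTypeClass hQs hT₀)) z)) :=
  ⟨cellData_wellFormed K q hQs hT₀ hxyz, fun i j σ => cellGammaFun_revXY K q _ hxyz i j σ⟩

/-- **The realising `Y`-block is useful for `T₀` w.r.t. the cell distributions.** [cite: AlmanDuanVassilevskaWilliamsXuXuZhou2025, Def. 5.8 and Thm. 5.3 (proof)] -/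
theorem isUsefulFor_cell_y (hlev : IsLevelTriple c (seqVal T₀.1) (seqVal T₀.2.1) (seqVal T₀.2.2))
    (hy : levelSeq y ∈ levelBlocksY (tripleTermMap hlev) (tripleTermList c γX γY γZ) ε)
    (a b : Fin (constituentTriples c).card → (Fin c → Fin 3) → Fin (n + 1)) :
    chunkLevels (levelSeq y) = seqVal T₀.2.1 ∧
      IsUsefulFor (cellGammaFun (tripleTermMap hlev) (profileOf q (tripleTermMap hlev) y))
        (seqVal T₀.1) (seqVal T₀.2.1) (seqVal T₀.2.2) (levelSeq y) := by
  have hmem : levelSeq y ∈ levelBlocksY (tripleTermMap hlev)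
      (cellTermList (tripleTermMap hlev) (tripleTermList c γX γY γZ) (a, profileOf q (tripleTermMap hlev) y, b)) 0 :=
    (mem_admissibleSeqs_cell_iff hy (levelSeq y)).2 rfl
  rw [← tripleTermList_cellGammaFun, mem_levelBlocksY_triple_iff hlev] at hmem
  exact hmem

/-- **The pair `(Y_{J₀}, realising Y-block)` is a typical `Y`-pair of the cell data** (useful ⇒ typical).
[cite: AlmanDuanVassilevskaWilliamsXuXuZhou2025, Def. 5.13 and Claim 5.12 (proof)] -/
theorem mem_typicalPairsY_cell (hQs : ∀ s, s ∉ levelSupport (2 * c) → Q s = 0) (hT₀ : T₀ ∈ jointTypeClass n Q)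
    (hy : levelSeq y ∈ levelBlocksY (tripleTermMap (isLevelTriple_of_mem_jointTypeClass hQs hT₀)) (tripleTermList c γX γY γZ) ε)
    (a b : Fin (constituentTriples c).card → (Fin c → Fin 3) → Fin (n + 1)) :
    (T₀.2.1, levelSeq y) ∈ (cellData Q (tripleTermMap (isLevelTriple_of_mem_jointTypeClass hQs hT₀))
      (a, profileOf q (tripleTermMap (isLevelTriple_of_mem_jointTypeClass hQs hT₀)) y, b)).typicalPairsY := by
  classical
  have hlev := isLevelTriple_of_mem_jointTypeClass hQs hT₀
  obtain ⟨hly, hu⟩ := isUsefulFor_cell_y q hlev hy a b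
  unfold GlobalStageData.typicalPairsY
  refine mem_filter.2 ⟨mem_univ _, ?_, ?_, ?_⟩
  · have hsub := jointTypeClass_subset_typedSupport (levelSupport (2 * c)) Q hQs hT₀
    exact (mem_typedSupport.1 hsub).2.1
  · exact chunkLevels_eq_iff.1 hly
  · exact hu.isTypicalY hlev (isAlphaConsistent_typeAlpha hT₀)

end Realised

/-! ## The class types `k^Y_S` of the realising `Y`-block (the integral data of Claim 5.17) -/

section CoarseYProfile

variable {c n : ℕ}

/-- **The class types of a level-1 `Y`-sequence**: for each coarse `Y`-class `S` (Claim 5.18) and chunk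
shape `σ`, the number of chunks of `S` of shape `σ` (so `k_S/|S| = split(Ĵ, S)`).
[cite: AlmanDuanVassilevskaWilliamsXuXuZhou2025, Claim 5.17 (proof) and Claim 5.18] -/
def coarseYProfile {I J K : Fin n → ℕ} (h : IsLevelTriple c I J K) (Jh : Fin n → Fin c → Fin 3) :
    Fin (coarseYClasses c).card → (Fin c → Fin 3) → ℕ :=
  fun s σ => ((termFibre (coarseYTermMap h) s).filter fun u => Jh u = σ).card

/-- `∑_σ k_S(σ) = |S|`. [folklore] -/
theorem sum_coarseYProfile {I J K : Fin n → ℕ} (h : IsLevelTriple c I J K) (Jh : Fin n → Fin c → Fin 3)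
    (s : Fin (coarseYClasses c).card) : ∑ σ, coarseYProfile h Jh s σ = (termFibre (coarseYTermMap h) s).card := by
  unfold coarseYProfile
  exact (card_eq_sum_card_fiberwise (f := Jh) (s := termFibre (coarseYTermMap h) s) (t := univ)
    fun _ _ => mem_univ _).symm

/-- For a sequence admissible for the coarse `Y`-datum, `k_S` is supported on shapes of the class level. [cite: AlmanDuanVassilevskaWilliamsXuXuZhou2025, Claim 5.17 (proof)] -/
theorem patternLevel_of_coarseYProfile_ne_zero {α : ℕ × ℕ × ℕ → ℝ} {γY : ℕ × ℕ × ℕ → (Fin c → Fin 3) → ℝ}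
    {I J K : Fin n → ℕ} (h : IsLevelTriple c I J K) {Jh : Fin n → Fin c → Fin 3}
    (hJ : Jh ∈ levelBlocksX (coarseYTermMap h) (coarseYTermList c α γY) 0) {s : Fin (coarseYClasses c).card}
    {σ : Fin c → Fin 3} (hne : coarseYProfile h Jh s σ ≠ 0) : patternLevel σ = (coarseYTermList c α γY s).i := by
  unfold coarseYProfile at hne
  obtain ⟨u, hu⟩ := card_pos.1 (Nat.pos_of_ne_zero hne)
  rw [mem_filter] at hu
  obtain ⟨hu1, hu2⟩ := hu
  have hus : coarseYTermMap h u = s := by simpa [termFibre] using hu1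
  have hlevel := (mem_admissibleSeqs.1 hJ).1 u
  rw [← hu2, hlevel, hus]

/-- For a sequence admissible for the coarse `Y`-datum, **`k_S = |S| · β_S`**. [cite: AlmanDuanVassilevskaWilliamsXuXuZhou2025, Claim 5.17 (proof)] -/
theorem coarseYProfile_eq_mul {α : ℕ × ℕ × ℕ → ℝ} {γY : ℕ × ℕ × ℕ → (Fin c → Fin 3) → ℝ}
    {I J K : Fin n → ℕ} (h : IsLevelTriple c I J K) {Jh : Fin n → Fin c → Fin 3}
    (hJ : Jh ∈ levelBlocksX (coarseYTermMap h) (coarseYTermList c α γY) 0) (s : Fin (coarseYClasses c).card)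
    (σ : Fin c → Fin 3) :
    (coarseYProfile h Jh s σ : ℝ) = (termFibre (coarseYTermMap h) s).card * (coarseYTermList c α γY s).γX σ := by
  have hmul : (coarseYProfile h Jh s σ : ℝ) = completeSplitOn Jh (termFibre (coarseYTermMap h) s) σ *
      (termFibre (coarseYTermMap h) s).card := (completeSplitOn_mul_card Jh _ σ).symm
  rcases (termFibre (coarseYTermMap h) s).eq_empty_or_nonempty with h0 | hne
  · rw [hmul, h0, card_empty, Nat.cast_zero, mul_zero, zero_mul]
  · have hcons := (mem_admissibleSeqs.1 hJ).2 s hne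
    rw [splitConsistentOn_zero_iff] at hcons
    have hσ : completeSplitOn Jh (termFibre (coarseYTermMap h) s) σ = (coarseYTermList c α γY s).γX σ := by
      have := congrFun hcons σ; simpa using this
    rw [hmul, hσ, mul_comm]

end CoarseYProfile

/-! ## The uniform bound on the modulus `M₀` -/

section Crude

variable {c n M : ℕ}

/-- **`M₀ ≤ crudeModulus`** for every datum and every pair of pairs (more asymmetric `M₀`).
[cite: AlmanDuanVassilevskaWilliamsXuXuZhou2025, §5.5 eq. (M₀ final)] -/
theorem GlobalStageData.MoreAsym.modulusBound_le_crudeModulus (D : GlobalStageData c n M)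
    (pY pZ : (Fin n → Fin (2 * c + 1)) × (Fin n → Fin c → Fin 3)) :
    GlobalStageData.MoreAsym.modulusBound D pY pZ ≤ crudeModulus c n := by
  classical
  set F := (2 * c + 1) ^ (3 * n) with hF
  have hT : D.tripleSet.card ≤ F := by rw [hF, ← card_tripleSeqs c n]; exact card_le_univ _
  have hVY : (D.compatTriplesY pY.1 pY.2).card ≤ F := by rw [hF, ← card_tripleSeqs c n]; exact card_le_univ _
  have hVZ : (D.compatTriples pZ.1 pZ.2).card ≤ F := by rw [hF, ← card_tripleSeqs c n]; exact card_le_univ _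
  have hF1 : 1 ≤ F := Nat.one_le_pow _ _ (by omega)
  have hXdiv : 8 * D.tripleSet.card / (typeClass n D.μX).card + 1 ≤ 8 * F + 1 :=
    Nat.add_le_add_right ((Nat.div_le_self _ _).trans (Nat.mul_le_mul_left 8 hT)) 1
  have h8 : 8 * F + 1 ≤ crudeModulus c n := by
    unfold crudeModulus; rw [← hF]
    calc 8 * F + 1 ≤ 8 * F + 3 * F := by omega
      _ = 11 * F := by ring
      _ ≤ (160 * (c * n) + 2 * c + 11) * F := Nat.mul_le_mul_right _ (by omega)
  have h160Y : 160 * (c * n) * (D.compatTriplesY pY.1 pY.2).card ≤ crudeModulus c n := by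
    unfold crudeModulus; rw [← hF]
    calc 160 * (c * n) * (D.compatTriplesY pY.1 pY.2).card ≤ 160 * (c * n) * F := Nat.mul_le_mul_left _ hVY
      _ ≤ (160 * (c * n) + 2 * c + 11) * F := Nat.mul_le_mul_right _ (by omega)
  have h160Z : 160 * (c * n) * (D.compatTriples pZ.1 pZ.2).card ≤ crudeModulus c n := by
    unfold crudeModulus; rw [← hF]
    calc 160 * (c * n) * (D.compatTriples pZ.1 pZ.2).card ≤ 160 * (c * n) * F := Nat.mul_le_mul_left _ hVZ
      _ ≤ (160 * (c * n) + 2 * c + 11) * F := Nat.mul_le_mul_right _ (by omega)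
  have h2c : 2 * c + 2 ≤ crudeModulus c n := by
    unfold crudeModulus; rw [← hF]
    calc 2 * c + 2 = (2 * c + 2) * 1 := (mul_one _).symm
      _ ≤ (2 * c + 2) * F := Nat.mul_le_mul_left _ hF1
      _ ≤ (160 * (c * n) + 2 * c + 11) * F := Nat.mul_le_mul_right _ (by omega)
  unfold GlobalStageData.MoreAsym.modulusBound
  exact max_le (max_le (hXdiv.trans h8) h160Y) (max_le h160Z h2c)

/-- The square-root term of the error is monotone in the modulus bound. [folklore] -/
theorem GlobalStageData.MoreAsym.sqrt_log_modulusBound_le (D : GlobalStageData c n M)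
    (pY pZ : (Fin n → Fin (2 * c + 1)) × (Fin n → Fin c → Fin 3)) :
    4 * Real.sqrt (Real.log (2 * GlobalStageData.MoreAsym.modulusBound D pY pZ)) / Real.log 2 ≤
      4 * Real.sqrt (Real.log (2 * crudeModulus c n)) / Real.log 2 := by
  have hpos : 0 < GlobalStageData.MoreAsym.modulusBound D pY pZ := by
    have : 2 * c + 2 ≤ GlobalStageData.MoreAsym.modulusBound D pY pZ := le_max_of_le_right (le_max_right _ _)
    omega
  have hle : (GlobalStageData.MoreAsym.modulusBound D pY pZ : ℝ) ≤ crudeModulus c n := by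
    exact_mod_cast GlobalStageData.MoreAsym.modulusBound_le_crudeModulus D pY pZ
  have h0 : (0 : ℝ) < 2 * GlobalStageData.MoreAsym.modulusBound D pY pZ := by positivity
  refine div_le_div_of_nonneg_right ?_ (Real.log_nonneg one_le_two)
  refine mul_le_mul_of_nonneg_left (Real.sqrt_le_sqrt (Real.log_le_log h0 (by linarith))) (by norm_num)

end Crude

/-! ## Prop. 5.1 (more asymmetric) applied to a realised cell -/

section Cell

variable (K : Type u) [CommSemiring K] (q : ℕ) {c n : ℕ}
variable {Q : Fin (2 * c + 1) × Fin (2 * c + 1) × Fin (2 * c + 1) → ℕ}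
variable {T₀ : (Fin n → Fin (2 * c + 1)) × (Fin n → Fin (2 * c + 1)) × (Fin n → Fin (2 * c + 1))}
variable {γX γY γZ : ℕ × ℕ × ℕ → (Fin c → Fin 3) → ℝ} {ε : ℝ} {x y z : Fin n → Fin c → Fin (q + 2)}

/-- The realising `Y`-block is admissible for the coarse `Y`-datum of the cell (useful ⇒ `Y`-compatible ⇒
the form of Claim 5.18). [cite: AlmanDuanVassilevskaWilliamsXuXuZhou2025, Claim 5.18 and Claim 5.12 (proof)] -/
theorem mem_levelBlocksX_coarseY_cell (hQs : ∀ s, s ∉ levelSupport (2 * c) → Q s = 0) (hT₀ : T₀ ∈ jointTypeClass n Q)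
    (hy : levelSeq y ∈ levelBlocksY (tripleTermMap (isLevelTriple_of_mem_jointTypeClass hQs hT₀)) (tripleTermList c γX γY γZ) ε) :
    levelSeq y ∈ levelBlocksX (coarseYTermMap (isLevelTriple_of_mem_jointTypeClass hQs hT₀))
      (coarseYTermList c (typeAlpha n Q)
        (cellGammaFun (tripleTermMap (isLevelTriple_of_mem_jointTypeClass hQs hT₀))
          (profileOf q (tripleTermMap (isLevelTriple_of_mem_jointTypeClass hQs hT₀)) y))) 0 := by
  have hlev := isLevelTriple_of_mem_jointTypeClass hQs hT₀
  have hα := isAlphaConsistent_typeAlpha hT₀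
  obtain ⟨hly, hu⟩ := isUsefulFor_cell_y q hlev hy (profileOf q (tripleTermMap hlev) y) (profileOf q (tripleTermMap hlev) y)
  exact (mem_levelBlocksX_coarseY_iff hlev (levelSeq y)).2
    ⟨hly, (advxxz2025_claim518 hlev hα (levelSeq y)).1 (hu.isYCompatibleWith hlev hα)⟩

/-- **ADVXXZ Thm. 5.3, one copy of the input per cell** (the more asymmetric Prop. 5.1 applied with the
realised split distributions of a cell of `𝒯_{τ₀, L(β), ε}` as targets): for a joint type `Q` (`∑ Q = n`,
supported on level triples), a triple `T₀` of type `Q` (term map `τ₀`), target split distributions `β`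
and a non-zero entry `(x, y, z)` of the `ε`-interface tensor, `(CW_q^{⊗c})^{⊗n}` restricts to `⟨κ⟩`
copies of the EXACT interface tensor of the cell of `(x, y, z)`, with
`log₂(κ+1) ≥ n · min{H(Q_X/n) − P, H(θ_y/n) − Λ^Y_y/n, H(θ_z/n) − Λ^Z_z/n, H(Q/n)} − thm53Err`, where
`P = maxEnt(Q/n) − H(Q/n)` is the penalty at the type, `θ_y` the joint type of `(J₀, ŷ)` with
`Λ^Y_y = ∑_S |S| H(k^Y_S/|S|)` over the Claim-5.18 classes (`= n η_Y` at the realised distributions), and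
`θ_z`, `Λ^Z_z` likewise for `(K₀, ẑ)` over the VXXZ Def-5.15 classes (`= n λ_Z`).
[cite: AlmanDuanVassilevskaWilliamsXuXuZhou2025, Thm. 5.3 and Prop. 5.1] -/
theorem advxxz2025_thm53_cell (hc : 0 < c) (hn : 0 < n) (hQ : ∑ s, Q s = n)
    (hQs : ∀ s, s ∉ levelSupport (2 * c) → Q s = 0) (hT₀ : T₀ ∈ jointTypeClass n Q)
    (hxyz : interfaceTensor K q (tripleTermMap (isLevelTriple_of_mem_jointTypeClass hQs hT₀)) (tripleTermList c γX γY γZ) ε x y z ≠ 0) :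
    ∃ κ : ℕ,
      TensorRestrictsTo (kroneckerPow (kroneckerPow (bigCwTensor K q) c) n)
        (kroneckerTensor (unitTensor K κ)
          (interfaceTensor K q (tripleTermMap (isLevelTriple_of_mem_jointTypeClass hQs hT₀))
            (cellTermList (tripleTermMap (isLevelTriple_of_mem_jointTypeClass hQs hT₀)) (tripleTermList c γX γY γZ)
              (profileOf q (tripleTermMap (isLevelTriple_of_mem_jointTypeClass hQs hT₀)) x,
                profileOf q (tripleTermMap (isLevelTriple_of_mem_jointTypeClass hQs hT₀)) y,
                profileOf q (tripleTermMap (isLevelTriple_of_mem_jointTypeClass hQs hT₀)) z)) 0)) ∧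
      (n : ℝ) * min (min (shannonEntropy (fun i => ((∑ j, ∑ l, Q (i, j, l) : ℕ) : ℝ) / n) -
              (maxEntropyGivenMarginals (levelSupport (2 * c)) (fun s => (Q s : ℝ) / n) - shannonEntropy (fun s => (Q s : ℝ) / n)))
            (shannonEntropy (fun a => (letterCount (GlobalStageData.pairSeq T₀.2.1 (levelSeq y)) a : ℝ) / n) -
              (∑ s, ((termFibre (coarseYTermMap (isLevelTriple_of_mem_jointTypeClass hQs hT₀)) s).card : ℝ) *
                shannonEntropy (fun σ => (coarseYProfile (isLevelTriple_of_mem_jointTypeClass hQs hT₀) (levelSeq y) s σ : ℝ) /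
                  (termFibre (coarseYTermMap (isLevelTriple_of_mem_jointTypeClass hQs hT₀)) s).card)) / n))
          (min (shannonEntropy (fun a => (letterCount (GlobalStageData.pairSeq T₀.2.2 (levelSeq z)) a : ℝ) / n) -
              (∑ s, ((termFibre (coarseTermMap (isLevelTriple_of_mem_jointTypeClass hQs hT₀)) s).card : ℝ) *
                shannonEntropy (fun σ => (coarseProfile (isLevelTriple_of_mem_jointTypeClass hQs hT₀) (levelSeq z) s σ : ℝ) /
                  (termFibre (coarseTermMap (isLevelTriple_of_mem_jointTypeClass hQs hT₀)) s).card)) / n)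
            (shannonEntropy (fun s => (Q s : ℝ) / n))) - thm53Err c n ≤
        Real.logb 2 ((κ : ℝ) + 1) := by
  classical
  have hlev := isLevelTriple_of_mem_jointTypeClass hQs hT₀
  obtain ⟨hxm, hym, hzm⟩ := interfaceTensor_ne_zero K q hxyz
  set τ₀ := tripleTermMap (isLevelTriple_of_mem_jointTypeClass hQs hT₀) with hτ₀
  set D := cellData Q τ₀ (profileOf q τ₀ x, profileOf q τ₀ y, profileOf q τ₀ z) with hDdef
  have hD : GlobalStageData.MoreAsym.WellFormed D := cellData_moreAsymWellFormed K q hQs hT₀ hxyz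
  have hS : D.Symmetric := cellData_symmetric Q _ _
  have hT₀' : T₀ ∈ D.𝒯α := hT₀
  have hpY : (T₀.2.1, levelSeq y) ∈ D.typicalPairsY := mem_typicalPairsY_cell q hQs hT₀ hym _ _
  have hpZ : (T₀.2.2, levelSeq z) ∈ D.typicalPairs := mem_typicalPairs_cell q hQs hT₀ hzm _ _
  have hcoarseY := mem_levelBlocksX_coarseY_cell q hQs hT₀ hym
  have hcoarseZ := mem_levelBlocksX_coarse_cell q hQs hT₀ hzm
  obtain ⟨M, B, -, -, -, -, -, hres⟩ := D.advxxz2025_prop51_region_logb hD hS K q hc hn hT₀' hpY hpZ (Q := Q) rfl hQ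
    rfl rfl rfl (coarseYProfile hlev (levelSeq y)) (fun s σ => coarseYProfile_eq_mul hlev hcoarseY s σ)
    (fun s σ hne => patternLevel_of_coarseYProfile_ne_zero hlev hcoarseY hne) (sum_coarseYProfile hlev (levelSeq y))
    (coarseProfile hlev (levelSeq z)) (fun s σ => coarseProfile_eq_mul hlev hcoarseZ s σ)
    (fun s σ hne => patternLevel_of_coarseProfile_ne_zero hlev hcoarseZ hne) (sum_coarseProfile hlev (levelSeq z))
  obtain ⟨hrest, hbound⟩ := hres (le_refl (8 ^ (3 * Nat.log (2 * (c * n)) (3 ^ (c * n)) + 3)))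
  refine ⟨B.card * D.𝒯α.card / (2 * M ^ 2 * 8 ^ (3 * Nat.log (2 * (c * n)) (3 ^ (c * n)) + 3)), ?_, ?_⟩
  · rw [cellData_starTensor_eq K q hlev γX γY γZ] at hrest
    exact hrest
  · have hsq := GlobalStageData.MoreAsym.sqrt_log_modulusBound_le D (T₀.2.1, levelSeq y) (T₀.2.2, levelSeq z)
    refine le_trans ?_ hbound
    simp only [hDdef, cellData_μX] at hbound hsq ⊢
    unfold thm53Err
    linarith

end Cell

end Literature.Computability.AlgebraicComplexity
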